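import Mathlib
import Summits.Ventures.PercRepro2.Defs
import Summits.Ventures.PercRepro2.Independence
import Summits.Ventures.PercRepro2.GcBlockPush

/-!
# The bundle pushforward: an edge set with three admissible patterns collapses to two edges
(blind cell PercRepro2, typer-1 g57)

The measure-side tool of the **root bundle** reduction (a mark-free vertex set whose external
terminals are the two roots `a₁, a₂` and one further vertex `v`): on the admissible configurations
`G₀` (no `a₁ ↔ a₂` inside the bundle) the edge set `S` of the bundle acts through THREE patterns —
nothing, `a₁ – v`, `a₂ – v` — read off two Boolean observables `α, β` of `S`, never both true on
`G₀`. Two INDEPENDENT edges `eA = {a₁, v}`, `eB = {a₂, v}` of weights `q₁ = A / (A + N)`,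
`q₂ = B / (B + N)` have the same three patterns (`BundleG`: not both open) with masses
`(N, A, B) / c`, `c = (A + N)(B + N) / N`. This is the hat pushforward (`Hat.prob_hat_pushforward`,
`|W| = 1`, the observables the open edges) for an arbitrary edge set:

* **`bundleMap S eA eB α β`** — `ω` with its coordinates on `S` replaced by `α ω` at `eA`, `β ω` at
  `eB`, `false` elsewhere on `S`; **`bundleWeights S eA eB q₁ q₂ p`** — `q₁` at `eA`, `q₂` at
  `eB`, `0` elsewhere on `S`, `p` outside; **`BundleG eA eB`** — not both pattern edges open;
* **`massAB p G₀ α β a b`** `= P_p(G₀, α = a, β = b)` — the pattern masses `N = massAB … false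
  false`, `A = massAB … true false`, `B = massAB … false true`;
* **`prob_bundle_pushforward`**: `P_p(bundleMap⁻¹ Y ∩ G₀) = c · P_{bundleWeights}(Y ∩ BundleG)`
  for every event `Y` — the preimage splits along the three patterns (`preimage_bundleMap_inter`),
  each part is an `S`-event times a frozen event (`prob_inter_eq_mul_of_dependsOn_compl`,
  `prob_freeze`), and on the other side the pinning identity at `eB` then `eA` gives the same
  three frozen laws with the coefficients `q₁(1 − q₂), (1 − q₁) q₂, (1 − q₁)(1 − q₂)` (the fourth
  term, both open, is null on `BundleG`).

Standard axioms.
-/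

namespace Summit.Ventures.PercRepro2

open Block

namespace Bundle

section Defs

variable {E : Type*} [Fintype E] [DecidableEq E] {R : Type*} [CommRing R]

/-- The pattern with `a` at `eA`, `b` at `eB`, closed elsewhere. -/
def twoPat (eA eB : E) (a b : Bool) : E → Bool :=
  fun e => if e = eA then a else if e = eB then b else false

/-- **The bundle map**: the coordinates of `ω` on `S` are replaced by `α ω` at `eA`, `β ω` at `eB`
and `false` elsewhere on `S`; outside `S` nothing changes. -/
def bundleMap (S : Set E) [DecidablePred (· ∈ S)] (eA eB : E) (α β : Config E → Bool)
    (ω : Config E) : Config E :=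
  fun e => if e = eA then α ω else if e = eB then β ω else if e ∈ S then false else ω e

/-- **The bundle weights**: `q₁` at `eA`, `q₂` at `eB`, `0` elsewhere on `S`, `p` outside `S`. -/
def bundleWeights (S : Set E) [DecidablePred (· ∈ S)] (eA eB : E) (q₁ q₂ : R) (p : E → R) :
    E → R :=
  fun e => if e = eA then q₁ else if e = eB then q₂ else if e ∈ S then 0 else p e

/-- **The admissible configurations of the bundle graph**: not both pattern edges open. -/
def BundleG (eA eB : E) : Set (Config E) := {ω | ¬ (ω eA = true ∧ ω eB = true)}

/-- The pattern mass `P_p(G₀, α = a, β = b)`. -/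
noncomputable def massAB (p : E → R) (G₀ : Set (Config E)) (α β : Config E → Bool) (a b : Bool) :
    R :=
  prob p (G₀ ∩ {ω | α ω = a ∧ β ω = b})

omit [Fintype E] in
/-- `twoPat` at `eA`. -/
lemma twoPat_A (eA eB : E) (a b : Bool) : twoPat eA eB a b eA = a := by
  simp [twoPat]

omit [Fintype E] in
/-- `twoPat` at `eB ≠ eA`. -/
lemma twoPat_B {eA eB : E} (hAB : eA ≠ eB) (a b : Bool) : twoPat eA eB a b eB = b := by
  simp [twoPat, hAB.symm]

omit [Fintype E] in
/-- `bundleMap` at `eA`. -/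
lemma bundleMap_apply_A (S : Set E) [DecidablePred (· ∈ S)] (eA eB : E) (α β : Config E → Bool)
    (ω : Config E) : bundleMap S eA eB α β ω eA = α ω := by
  simp [bundleMap]

omit [Fintype E] in
/-- `bundleMap` at `eB ≠ eA`. -/
lemma bundleMap_apply_B (S : Set E) [DecidablePred (· ∈ S)] {eA eB : E} (hAB : eA ≠ eB)
    (α β : Config E → Bool) (ω : Config E) : bundleMap S eA eB α β ω eB = β ω := by
  simp [bundleMap, hAB.symm]

omit [Fintype E] in
/-- `bundleMap` on an edge of `S` other than `eA, eB`: closed. -/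
lemma bundleMap_apply_of_mem (S : Set E) [DecidablePred (· ∈ S)] {eA eB : E}
    (α β : Config E → Bool) (ω : Config E) {e : E} (hA : e ≠ eA) (hB : e ≠ eB) (he : e ∈ S) :
    bundleMap S eA eB α β ω e = false := by
  simp [bundleMap, hA, hB, he]

omit [Fintype E] in
/-- `bundleMap` on an edge outside `S` (`eA, eB ∈ S`): unchanged. -/
lemma bundleMap_apply_of_notMem (S : Set E) [DecidablePred (· ∈ S)] {eA eB : E} (hA : eA ∈ S)
    (hB : eB ∈ S) (α β : Config E → Bool) (ω : Config E) {e : E} (he : e ∉ S) :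
    bundleMap S eA eB α β ω e = ω e := by
  have h1 : e ≠ eA := fun h => he (h ▸ hA)
  have h2 : e ≠ eB := fun h => he (h ▸ hB)
  simp [bundleMap, h1, h2, he]

omit [Fintype E] in
/-- The bundle map is the freeze of `S` to the pattern `(α ω, β ω)`. -/
lemma bundleMap_eq_freeze (S : Set E) [DecidablePred (· ∈ S)] {eA eB : E} (hA : eA ∈ S)
    (hB : eB ∈ S) (α β : Config E → Bool) (ω : Config E) :
    bundleMap S eA eB α β ω = freeze S (twoPat eA eB (α ω) (β ω)) ω := by
  funext e
  by_cases h1 : e = eA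
  · subst h1; simp [bundleMap, freeze, twoPat, hA]
  · by_cases h2 : e = eB
    · subst h2; simp [bundleMap, freeze, twoPat, hB, h1]
    · by_cases he : e ∈ S
      · simp [bundleMap, freeze, twoPat, h1, h2, he]
      · simp [bundleMap, freeze, h1, h2, he]

omit [Fintype E] in
/-- On `G₀` (never both observables true) the preimage under the bundle map splits along the three
patterns. -/
lemma preimage_bundleMap_inter (S : Set E) [DecidablePred (· ∈ S)] {eA eB : E} (hA : eA ∈ S)
    (hB : eB ∈ S) {α β : Config E → Bool} {G₀ : Set (Config E)}
    (hG₀ : ∀ ω ∈ G₀, ¬ (α ω = true ∧ β ω = true)) (Y : Set (Config E)) :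
    bundleMap S eA eB α β ⁻¹' Y ∩ G₀ =
      (G₀ ∩ {ω | α ω = true ∧ β ω = false} ∩ freeze S (twoPat eA eB true false) ⁻¹' Y) ∪
        (G₀ ∩ {ω | α ω = false ∧ β ω = true} ∩ freeze S (twoPat eA eB false true) ⁻¹' Y) ∪
        (G₀ ∩ {ω | α ω = false ∧ β ω = false} ∩ freeze S (twoPat eA eB false false) ⁻¹' Y) := by
  ext ω
  simp only [Set.mem_inter_iff, Set.mem_preimage, Set.mem_union, Set.mem_setOf_eq,
    bundleMap_eq_freeze S hA hB α β ω]
  constructor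
  · rintro ⟨hY, hG⟩
    have hnb := hG₀ ω hG
    cases hα : α ω <;> cases hβ : β ω
    · exact Or.inr ⟨⟨hG, rfl, rfl⟩, by rw [hα, hβ] at hY; exact hY⟩
    · exact Or.inl (Or.inr ⟨⟨hG, rfl, rfl⟩, by rw [hα, hβ] at hY; exact hY⟩)
    · exact Or.inl (Or.inl ⟨⟨hG, rfl, rfl⟩, by rw [hα, hβ] at hY; exact hY⟩)
    · exact absurd ⟨hα, hβ⟩ hnb
  · rintro ((⟨⟨hG, hα, hβ⟩, hY⟩ | ⟨⟨hG, hα, hβ⟩, hY⟩) | ⟨⟨hG, hα, hβ⟩, hY⟩) <;>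
      exact ⟨by rw [hα, hβ]; exact hY, hG⟩

omit [Fintype E] [DecidableEq E] in
/-- The pattern event `{α = a, β = b}` of observables determined by `S` is determined by `S`. -/
lemma dependsOn_patEvent {S : Set E} {α β : Config E → Bool} (hα : DependsOn α S)
    (hβ : DependsOn β S) (a b : Bool) : DependsOn (· ∈ {ω : Config E | α ω = a ∧ β ω = b}) S := by
  intro ω ω' h
  show (α ω = a ∧ β ω = b) = (α ω' = a ∧ β ω' = b)
  rw [hα h, hβ h]

omit [Fintype E] [DecidableEq E] in
/-- The mass event `G₀ ∩ {α = a, β = b}` is determined by `S`. -/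
lemma dependsOn_massEvent {S : Set E} {α β : Config E → Bool} (hα : DependsOn α S)
    (hβ : DependsOn β S) {G₀ : Set (Config E)} (hG : DependsOn (· ∈ G₀) S) (a b : Bool) :
    DependsOn (· ∈ G₀ ∩ {ω : Config E | α ω = a ∧ β ω = b}) S := by
  have := dependsOn_inter hG (dependsOn_patEvent hα hβ a b)
  rwa [Set.union_self] at this

/-- A part of the split is the pattern mass times the frozen law of `Y`. -/
lemma prob_part (p : E → R) (S : Set E) [DecidablePred (· ∈ S)] {α β : Config E → Bool}
    (hα : DependsOn α S) (hβ : DependsOn β S) {G₀ : Set (Config E)} (hG : DependsOn (· ∈ G₀) S)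
    (a b : Bool) (σ : E → Bool) (Y : Set (Config E)) :
    prob p (G₀ ∩ {ω | α ω = a ∧ β ω = b} ∩ freeze S σ ⁻¹' Y) =
      massAB p G₀ α β a b * prob (frozenWeights S σ p) Y := by
  rw [prob_inter_eq_mul_of_dependsOn_compl p S (dependsOn_massEvent hα hβ hG a b)
    (dependsOn_freeze S σ Y), ← prob_freeze]
  rfl

omit [Fintype E] [DecidableEq E] in
/-- Two distinct pattern events are disjoint. -/
lemma disjoint_massEvent {α β : Config E → Bool} (G₀ : Set (Config E)) {a b a' b' : Bool}
    (h : (a, b) ≠ (a', b')) (X X' : Set (Config E)) :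
    Disjoint (G₀ ∩ {ω | α ω = a ∧ β ω = b} ∩ X) (G₀ ∩ {ω | α ω = a' ∧ β ω = b'} ∩ X') := by
  rw [Set.disjoint_left]
  rintro ω ⟨⟨_, hα, hβ⟩, _⟩ ⟨⟨_, hα', hβ'⟩, _⟩
  exact h (by rw [← hα, ← hβ, ← hα', ← hβ'])

end Defs

/-! ## The bundle weights pinned at the two pattern edges -/

section Weights

variable {E : Type*} [Fintype E] [DecidableEq E] {R : Type*} [CommRing R]

omit [Fintype E] in
/-- The bundle weights are the frozen-closed weights updated at `eA` and `eB`. -/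
lemma bundleWeights_eq_update (S : Set E) [DecidablePred (· ∈ S)] {eA eB : E} (hAB : eA ≠ eB)
    (q₁ q₂ : R) (p : E → R) :
    bundleWeights S eA eB q₁ q₂ p =
      Function.update (Function.update (frozenWeights S (fun _ => false) p) eA q₁) eB q₂ := by
  funext e
  by_cases h2 : e = eB
  · subst h2; simp [bundleWeights, hAB.symm]
  · rw [Function.update_of_ne h2]
    by_cases h1 : e = eA
    · subst h1; simp [bundleWeights]
    · rw [Function.update_of_ne h1]
      simp [bundleWeights, frozenWeights, h1, h2]

omit [Fintype E] in
/-- Pinning the bundle weights at `eB` to `b` and at `eA` to `a` gives the frozen weights of the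
pattern `(a, b)`. -/
lemma update_update_bundleWeights (S : Set E) [DecidablePred (· ∈ S)] {eA eB : E} (hA : eA ∈ S)
    (hB : eB ∈ S) (hAB : eA ≠ eB) (q₁ q₂ : R) (p : E → R) (a b : Bool) :
    Function.update (Function.update (bundleWeights S eA eB q₁ q₂ p) eB (if b then 1 else 0)) eA
        (if a then 1 else 0) = frozenWeights S (twoPat eA eB a b) p := by
  funext e
  by_cases h1 : e = eA
  · subst h1
    simp [frozenWeights, twoPat, hA]
  · rw [Function.update_of_ne h1]
    by_cases h2 : e = eB
    · subst h2
      simp [frozenWeights, twoPat, hB, h1]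
    · rw [Function.update_of_ne h2]
      simp [bundleWeights, frozenWeights, twoPat, h1, h2]

omit [DecidableEq E] in
/-- Under the frozen weights of `σ`, a configuration differing from `σ` at an edge of `S` has
weight zero. -/
lemma weight_frozen_eq_zero (S : Set E) [DecidablePred (· ∈ S)] (σ : E → Bool) (p : E → R)
    {ω : Config E} {e : E} (he : e ∈ S) (hne : ω e ≠ σ e) :
    weight (frozenWeights S σ p) ω = 0 := by
  unfold weight
  refine Finset.prod_eq_zero (Finset.mem_univ e) ?_
  cases hω : ω e <;> cases hσ : σ e <;> simp_all [frozenWeights, edgeFactor]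

/-- Under the frozen weights of a pattern with both `eA, eB` open, the admissible configurations
are null. -/
lemma prob_frozen_inter_bundleG_eq_zero (S : Set E) [DecidablePred (· ∈ S)] {eA eB : E}
    (hA : eA ∈ S) (hB : eB ∈ S) {σ : E → Bool} (hσ : σ eA = true ∧ σ eB = true) (p : E → R)
    (Y : Set (Config E)) : prob (frozenWeights S σ p) (Y ∩ BundleG eA eB) = 0 := by
  unfold prob
  refine Finset.sum_eq_zero fun ω _ => ?_
  by_cases hω : ω ∈ Y ∩ BundleG eA eB
  · rw [Set.indicator_of_mem hω]
    have hG : ¬ (ω eA = true ∧ ω eB = true) := hω.2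
    by_cases hωA : ω eA = true
    · have hωB : ω eB ≠ σ eB := by
        rw [hσ.2]
        exact fun h => hG ⟨hωA, h⟩
      exact weight_frozen_eq_zero S σ p hB hωB
    · have hωA' : ω eA ≠ σ eA := by rw [hσ.1]; exact hωA
      exact weight_frozen_eq_zero S σ p hA hωA'
  · rw [Set.indicator_of_notMem hω]

/-- Under the frozen weights of an admissible pattern, the admissible configurations are sure. -/
lemma prob_frozen_inter_bundleG (S : Set E) [DecidablePred (· ∈ S)] {eA eB : E} (hA : eA ∈ S)
    (hB : eB ∈ S) {σ : E → Bool} (hσ : ¬ (σ eA = true ∧ σ eB = true)) (p : E → R)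
    (Y : Set (Config E)) :
    prob (frozenWeights S σ p) (Y ∩ BundleG eA eB) = prob (frozenWeights S σ p) Y := by
  unfold prob
  refine Finset.sum_congr rfl fun ω _ => ?_
  by_cases hG : ω ∈ BundleG eA eB
  · by_cases hY : ω ∈ Y
    · rw [Set.indicator_of_mem (show ω ∈ Y ∩ BundleG eA eB from ⟨hY, hG⟩), Set.indicator_of_mem hY]
    · rw [Set.indicator_of_notMem (show ω ∉ Y ∩ BundleG eA eB from fun h => hY h.1),
        Set.indicator_of_notMem hY]
  · -- both `eA, eB` open in `ω`, so `ω` differs from `σ` at one of them: weight zero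
    rw [Set.indicator_of_notMem (fun h => hG h.2)]
    have hboth : ω eA = true ∧ ω eB = true := by
      by_contra hc
      exact hG hc
    by_cases hσA : σ eA = true
    · have hσB : σ eB ≠ true := fun h => hσ ⟨hσA, h⟩
      have : ω eB ≠ σ eB := by rw [hboth.2]; exact fun h => hσB h.symm
      rw [Set.indicator_apply_eq_zero.2 fun _ => weight_frozen_eq_zero S σ p hB this]
    · have : ω eA ≠ σ eA := by rw [hboth.1]; exact fun h => hσA h.symm
      rw [Set.indicator_apply_eq_zero.2 fun _ => weight_frozen_eq_zero S σ p hA this]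

end Weights

/-! ## The bundle pushforward -/

section Push

variable {E : Type*} [Fintype E] [DecidableEq E] {R : Type*} [Field R]

/-- The weight of the pattern edge `eA` in the bundle graph: `q₁ = A / (A + N)`. -/
noncomputable def bundleQ1 (p : E → R) (G₀ : Set (Config E)) (α β : Config E → Bool) : R :=
  massAB p G₀ α β true false / (massAB p G₀ α β true false + massAB p G₀ α β false false)

/-- The weight of the pattern edge `eB` in the bundle graph: `q₂ = B / (B + N)`. -/
noncomputable def bundleQ2 (p : E → R) (G₀ : Set (Config E)) (α β : Config E → Bool) : R :=
  massAB p G₀ α β false true / (massAB p G₀ α β false true + massAB p G₀ α β false false)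

/-- The scale factor of the bundle: `c = (A + N)(B + N) / N`. -/
noncomputable def bundleC (p : E → R) (G₀ : Set (Config E)) (α β : Config E → Bool) : R :=
  (massAB p G₀ α β true false + massAB p G₀ α β false false) *
    (massAB p G₀ α β false true + massAB p G₀ α β false false) / massAB p G₀ α β false false

/-- The law of the bundle weights on the admissible configurations, pinned at `eB` then `eA`:
three frozen laws with the coefficients `q₁ (1 − q₂)`, `(1 − q₁) q₂`, `(1 − q₁)(1 − q₂)`. -/
lemma prob_bundleWeights_inter_bundleG (p : E → R) (S : Set E) [DecidablePred (· ∈ S)]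
    {eA eB : E} (hA : eA ∈ S) (hB : eB ∈ S) (hAB : eA ≠ eB) (q₁ q₂ : R) (Y : Set (Config E)) :
    prob (bundleWeights S eA eB q₁ q₂ p) (Y ∩ BundleG eA eB) =
      q₁ * (1 - q₂) * prob (frozenWeights S (twoPat eA eB true false) p) Y +
        (1 - q₁) * q₂ * prob (frozenWeights S (twoPat eA eB false true) p) Y +
        (1 - q₁) * (1 - q₂) * prob (frozenWeights S (twoPat eA eB false false) p) Y := by
  have hwB : bundleWeights S eA eB q₁ q₂ p eB = q₂ := by simp [bundleWeights, hAB.symm]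
  have hwA1 : Function.update (bundleWeights S eA eB q₁ q₂ p) eB 1 eA = q₁ := by
    rw [Function.update_of_ne hAB]; simp [bundleWeights]
  have hwA0 : Function.update (bundleWeights S eA eB q₁ q₂ p) eB 0 eA = q₁ := by
    rw [Function.update_of_ne hAB]; simp [bundleWeights]
  have h11 := update_update_bundleWeights S hA hB hAB q₁ q₂ p true true
  have h01 := update_update_bundleWeights S hA hB hAB q₁ q₂ p false true
  have h10 := update_update_bundleWeights S hA hB hAB q₁ q₂ p true false
  have h00 := update_update_bundleWeights S hA hB hAB q₁ q₂ p false false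
  simp only [Bool.false_eq_true, ite_true, ite_false] at h11 h01 h10 h00
  have hz := prob_frozen_inter_bundleG_eq_zero S hA hB (σ := twoPat eA eB true true)
    ⟨twoPat_A eA eB true true, twoPat_B hAB true true⟩ p Y
  have h01' := prob_frozen_inter_bundleG S hA hB (σ := twoPat eA eB false true)
    (by rw [twoPat_A, twoPat_B hAB]; simp) p Y
  have h10' := prob_frozen_inter_bundleG S hA hB (σ := twoPat eA eB true false)
    (by rw [twoPat_A, twoPat_B hAB]; simp) p Y
  have h00' := prob_frozen_inter_bundleG S hA hB (σ := twoPat eA eB false false)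
    (by rw [twoPat_A, twoPat_B hAB]; simp) p Y
  rw [prob_eq_pin (bundleWeights S eA eB q₁ q₂ p) _ eB,
    prob_eq_pin (Function.update (bundleWeights S eA eB q₁ q₂ p) eB 1) _ eA,
    prob_eq_pin (Function.update (bundleWeights S eA eB q₁ q₂ p) eB 0) _ eA, hwB, hwA1, hwA0,
    h11, h01, h10, h00, hz, h01', h10', h00']
  ring

/-- **THE BUNDLE PUSHFORWARD**: for observables `α, β` of the edge set `S` and an `S`-event `G₀` on
which they are never both true, the law of `G₀` under the bundle map is `c` times the law of the
admissible configurations under the bundle weights, for every event. -/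
theorem prob_bundle_pushforward (p : E → R) (S : Set E) [DecidablePred (· ∈ S)] {eA eB : E}
    (hA : eA ∈ S) (hB : eB ∈ S) (hAB : eA ≠ eB) {α β : Config E → Bool} (hα : DependsOn α S)
    (hβ : DependsOn β S) {G₀ : Set (Config E)} (hG : DependsOn (· ∈ G₀) S)
    (hG₀ : ∀ ω ∈ G₀, ¬ (α ω = true ∧ β ω = true)) (hN : massAB p G₀ α β false false ≠ 0)
    (hAN : massAB p G₀ α β true false + massAB p G₀ α β false false ≠ 0)
    (hBN : massAB p G₀ α β false true + massAB p G₀ α β false false ≠ 0) (Y : Set (Config E)) :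
    prob p (bundleMap S eA eB α β ⁻¹' Y ∩ G₀) =
      bundleC p G₀ α β *
        prob (bundleWeights S eA eB (bundleQ1 p G₀ α β) (bundleQ2 p G₀ α β) p)
          (Y ∩ BundleG eA eB) := by
  have hd1 : Disjoint (G₀ ∩ {ω | α ω = true ∧ β ω = false} ∩ freeze S (twoPat eA eB true false) ⁻¹' Y)
      (G₀ ∩ {ω | α ω = false ∧ β ω = true} ∩ freeze S (twoPat eA eB false true) ⁻¹' Y) :=
    disjoint_massEvent G₀ (by decide) _ _
  have hd2 : Disjoint (G₀ ∩ {ω | α ω = true ∧ β ω = false} ∩ freeze S (twoPat eA eB true false) ⁻¹' Y)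
      (G₀ ∩ {ω | α ω = false ∧ β ω = false} ∩ freeze S (twoPat eA eB false false) ⁻¹' Y) :=
    disjoint_massEvent G₀ (by decide) _ _
  have hd3 : Disjoint (G₀ ∩ {ω | α ω = false ∧ β ω = true} ∩ freeze S (twoPat eA eB false true) ⁻¹' Y)
      (G₀ ∩ {ω | α ω = false ∧ β ω = false} ∩ freeze S (twoPat eA eB false false) ⁻¹' Y) :=
    disjoint_massEvent G₀ (by decide) _ _
  rw [preimage_bundleMap_inter S hA hB hG₀ Y,
    prob_union_of_disjoint p (Set.disjoint_union_left.2 ⟨hd2, hd3⟩), prob_union_of_disjoint p hd1,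
    prob_part p S hα hβ hG, prob_part p S hα hβ hG, prob_part p S hα hβ hG,
    prob_bundleWeights_inter_bundleG p S hA hB hAB]
  unfold bundleC bundleQ1 bundleQ2
  field_simp
  ring

end Push

end Bundle

end Summit.Ventures.PercRepro2
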